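import Summits.AtomisticToContinuum.BoseEinsteinCondensation.Theses.BECNudgeWalk
import Summits.AtomisticToContinuum.BoseEinsteinCondensation.Theorems.BECNudgeWalkNudgeRemovalWalkStep
import Summits.AtomisticToContinuum.BoseEinsteinCondensation.Theorems.BECNudgeWalkNudgeRemovalNudgedClustering
import Summits.AtomisticToContinuum.BoseEinsteinCondensation.Theorems.BECNudgeWalkNudgeRemovalDepletionOfVariance
import Summits.AtomisticToContinuum.BoseEinsteinCondensation.Theorems.BECNudgeWalkNudgeRemovalWalkInduction

/-!
# Route `BECNudgeWalk`, support item `WalkGlue` (stmt-AtomisticToContinuum-14363):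
# `NudgedCondensation → NudgeGap → CondensateVariance → NudgeRemoval`

Sub-problem `BoseEinsteinCondensation` of `AtomisticToContinuum`; written by the lead of the crux line
`registered`/`birth` of `NudgeRemoval` (stmt-AtomisticToContinuum-14361), whose skeleton
(`Cruxes/NudgeRemoval/Lines/birth.lean`) is this file plus the three shared route-item stubs.

The route's removal mechanism, typed VARIATIONALLY at fixed `(N, L)` (no operator theory is available for
the rewarded infimum `R(t) = inf_Ψ [energy Ψ + t(N − n₀(Ψ))]` over `C¹` Dirichlet trial states): the
currency is uniform condensation of near-minimisers, `Cond(t, β) ≡ ∃ δ > 0, every δ-near-minimiser of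
F_t has n₀ ≥ (1 − β)N`, literally the hypothesis form of the cruxes `NudgeGap` / `CondensateVariance`.

* `rewardWalk` — the reward walk at fixed `N` (`K = 512`): condensation at level `b` at the top reward
  `s₁` propagates to level `b' ≥ b + (KC/c)√(s₁/(ρa))` at every `t ∈ (0, s₁]` as long as `b' < η` keeps
  the walk inside the regime where the Ky-Fan gap `c√(ρa t)` and the variance bound `CN` hold. One step
  (`abstract_step`, file `…WalkStep`): clustering of nudged near-minimisers from the Ky-Fan gap
  (`Registered.stub_nudgedClustering`, parallelogram law) + the depletion increment
  `N − n₀(Ψ') ≤ N − n₀(Ψ) + Nη² + 2√(CN)η` (`Registered.stub_depletionOfVariance`, `n̂₀ = a₀†a₀`,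
  Cauchy–Schwarz) + real bookkeeping (`step_arith`): a step of length `ε ≤ g/(16N)` costs `128εCN/g`;
  the finite induction along a `√s`-uniform mesh is `Registered.stub_walkInduction`.
* `cond_of_rung` (W0) — the rung `R(s₀) ≤ E₀ + s₀τ₀N` condenses the `s₀τ₀N`-near-minimisers of `F_{s₀}`
  at level `2τ₀`; `removal_of_cond` (W3) — uniform condensation at level `β` on `(0, s₁]` gives
  `R(s) ≤ E₀ + βsN` (test `F_s` on a near-minimiser of `F_t`, `t ↓ 0`); `nudgedInf_le`, `cond_mono`.
* `walkGlue_of_rewardWalk`, `walkGlue_proof : WalkGlue` — constants `η = min η_G η_V`,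
  `τ' = min τ (η/4)`, `θ = min 1 (cτ'/(4KC))²`; the rung at `(τ'/4, θ)` gives `Cond(s₀, τ'/2)`, the walk
  gives `Cond(t, τ')` on `(0, s₀]`, W3 gives `R(s) ≤ E₀ + τ'sN ≤ E₀ + 2τsN`; `a = 0` (`s₀ = 0`) is vacuous.

References: Kato, *Perturbation Theory for Linear Operators* (1966), II §6; Reed–Simon IV (1978),
XIII.1–2 (min–max / Ky Fan) — only their finite-difference, variational shadow is used here.
-/

noncomputable section

open MeasureTheory Filter
open scoped ENNReal NNReal ComplexConjugate

namespace Summit.AtomisticToContinuum.BoseEinsteinCondensation.Cruxes.NudgeRemoval.Birth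

open Literature.MathematicalPhysics.QuantumManyBody.BoseGas
open Summit.AtomisticToContinuum.BoseEinsteinCondensation.Theses.BECNudgeWalk
open Summit.AtomisticToContinuum.BoseEinsteinCondensation.Cruxes.NudgeRemoval

/-! ## `ℝ≥0∞` bookkeeping on trial states -/
/-- A-priori bound `R(t) ≤ E₀ + tN` (`N − n₀ ≤ N`, `ENNReal.iInf_add`). -/
theorem nudgedInf_le {N : ℕ} {L : ℝ} (v : ℝ → ℝ≥0∞) {t : ℝ} (ht : 0 ≤ t) :
    (⨅ Ψ : TrialState N L, (energy v Ψ +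
      ENNReal.ofReal t * ((N : ℝ≥0∞) - occupation N (constantMode L) Ψ.ψ))) ≤
      groundStateEnergy v N L + ENNReal.ofReal (t * N) := by
  calc (⨅ Ψ : TrialState N L, (energy v Ψ +
      ENNReal.ofReal t * ((N : ℝ≥0∞) - occupation N (constantMode L) Ψ.ψ)))
      ≤ ⨅ Ψ : TrialState N L, (energy v Ψ + ENNReal.ofReal t * (N : ℝ≥0∞)) :=
        iInf_mono fun Ψ => by gcongr; exact tsub_le_self
    _ = groundStateEnergy v N L + ENNReal.ofReal t * (N : ℝ≥0∞) := by
        rw [groundStateEnergy, ENNReal.iInf_add]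
    _ = groundStateEnergy v N L + ENNReal.ofReal (t * N) := by
        rw [ENNReal.ofReal_mul ht, ENNReal.ofReal_natCast]

/-- Monotonicity of the condensation predicate in the level. -/
theorem cond_mono {N : ℕ} {L : ℝ} {G : TrialState N L → ℝ≥0∞} {m : ℝ≥0∞} {β β' : ℝ}
    (h : ∃ δ : ℝ≥0∞, 0 < δ ∧ ∀ Ψ : TrialState N L, G Ψ ≤ m + δ →
      ENNReal.ofReal ((1 - β) * N) ≤ occupation N (constantMode L) Ψ.ψ)
    (hβ : β ≤ β') :
    ∃ δ : ℝ≥0∞, 0 < δ ∧ ∀ Ψ : TrialState N L, G Ψ ≤ m + δ →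
      ENNReal.ofReal ((1 - β') * N) ≤ occupation N (constantMode L) Ψ.ψ := by
  obtain ⟨δ, hδ, hΨ⟩ := h
  refine ⟨δ, hδ, fun Ψ hle => le_trans ?_ (hΨ Ψ hle)⟩
  exact ENNReal.ofReal_le_ofReal (by nlinarith [N.cast_nonneg (α := ℝ)])


/-! ## W0 and W3 -/
/-- **W0 — the rung condenses the nudged near-minimisers.** If `R(s₀) ≤ E₀ + s₀τ₀N` with
`E₀ < ⊤`, `s₀ > 0`, then every `s₀τ₀N`-near-minimiser of `F_{s₀}` has `n₀ ≥ (1 − 2τ₀)N`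
(`E₀ ≤ energy Ψ`, cancel `E₀`, divide by `s₀`). -/
theorem cond_of_rung {N : ℕ} {L : ℝ} (v : ℝ → ℝ≥0∞) {s₀ τ₀ : ℝ} (hs₀ : 0 < s₀) (hτ₀ : 0 < τ₀)
    (hN : 0 < N) (hE : groundStateEnergy v N L ≠ ⊤)
    (hR : (⨅ Ψ : TrialState N L, (energy v Ψ +
        ENNReal.ofReal s₀ * ((N : ℝ≥0∞) - occupation N (constantMode L) Ψ.ψ))) ≤
      groundStateEnergy v N L + ENNReal.ofReal (s₀ * τ₀ * N)) :
    ∃ δ : ℝ≥0∞, 0 < δ ∧ ∀ Ψ : TrialState N L,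
      energy v Ψ + ENNReal.ofReal s₀ * ((N : ℝ≥0∞) - occupation N (constantMode L) Ψ.ψ) ≤
        (⨅ Φ : TrialState N L, (energy v Φ +
          ENNReal.ofReal s₀ * ((N : ℝ≥0∞) - occupation N (constantMode L) Φ.ψ))) + δ →
      ENNReal.ofReal ((1 - 2 * τ₀) * N) ≤ occupation N (constantMode L) Ψ.ψ := by
  have hpos : 0 < s₀ * τ₀ * N := by positivity
  refine ⟨ENNReal.ofReal (s₀ * τ₀ * N), ENNReal.ofReal_pos.2 hpos, fun Ψ hΨ => ?_⟩
  set E₀ := groundStateEnergy v N L with hE₀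
  set n₀ := occupation N (constantMode L) Ψ.ψ with hn₀
  have h1 : energy v Ψ + ENNReal.ofReal s₀ * ((N : ℝ≥0∞) - n₀) ≤
      E₀ + (ENNReal.ofReal (s₀ * τ₀ * N) + ENNReal.ofReal (s₀ * τ₀ * N)) := by
    calc energy v Ψ + ENNReal.ofReal s₀ * ((N : ℝ≥0∞) - n₀)
        ≤ _ := hΨ
      _ ≤ (E₀ + ENNReal.ofReal (s₀ * τ₀ * N)) + ENNReal.ofReal (s₀ * τ₀ * N) := by
          gcongr
      _ = E₀ + (ENNReal.ofReal (s₀ * τ₀ * N) + ENNReal.ofReal (s₀ * τ₀ * N)) := add_assoc _ _ _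
  have h2 : E₀ ≤ energy v Ψ := groundStateEnergy_le_energy v Ψ
  have h3 : E₀ + ENNReal.ofReal s₀ * ((N : ℝ≥0∞) - n₀) ≤
      E₀ + (ENNReal.ofReal (s₀ * τ₀ * N) + ENNReal.ofReal (s₀ * τ₀ * N)) :=
    le_trans (by gcongr) h1
  have h4 : ENNReal.ofReal s₀ * ((N : ℝ≥0∞) - n₀) ≤
      ENNReal.ofReal (s₀ * τ₀ * N) + ENNReal.ofReal (s₀ * τ₀ * N) :=
    (ENNReal.add_le_add_iff_left hE).1 h3
  have h5 : ENNReal.ofReal (s₀ * τ₀ * N) + ENNReal.ofReal (s₀ * τ₀ * N) =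
      ENNReal.ofReal s₀ * ENNReal.ofReal (2 * τ₀ * N) := by
    rw [← ENNReal.ofReal_add hpos.le hpos.le, ← ENNReal.ofReal_mul hs₀.le]
    congr 1; ring
  rw [h5] at h4
  have h6 : ((N : ℝ≥0∞) - n₀) ≤ ENNReal.ofReal (2 * τ₀ * N) := by
    have hs0 : ENNReal.ofReal s₀ ≠ 0 := (ENNReal.ofReal_pos.2 hs₀).ne'
    exact (ENNReal.mul_le_mul_iff_right hs0 ENNReal.ofReal_ne_top).1 h4
  exact level_of_depletion_le (by positivity) h6

/-- **W3 — uniform condensation of the nudged near-minimisers down to `t → 0⁺` gives the crux's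
bound.** If for every `t ∈ (0, s₁]` the near-minimisers of `F_t` are condensed at level `β ≥ 0`,
then `R(s) ≤ E₀ + βsN` for every `s ∈ (0, s₁]`: test `F_s` on a near-minimiser `Ψ_t` of `F_t`
with `t ↓ 0` (`energy Ψ_t ≤ R(t) + δ ≤ E₀ + tN + δ`, depletion `≤ βN`) and let `t, δ → 0`. -/
theorem removal_of_cond {N : ℕ} {L : ℝ} (v : ℝ → ℝ≥0∞) {s s₁ β : ℝ} (hs : 0 < s)
    (hss : s ≤ s₁) (hβ : 0 ≤ β) (hN : 0 < N) (hE : groundStateEnergy v N L ≠ ⊤)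
    (hC : ∀ t : ℝ, 0 < t → t ≤ s₁ → ∃ δ : ℝ≥0∞, 0 < δ ∧ ∀ Ψ : TrialState N L,
        energy v Ψ + ENNReal.ofReal t * ((N : ℝ≥0∞) - occupation N (constantMode L) Ψ.ψ) ≤
          (⨅ Φ : TrialState N L, (energy v Φ +
            ENNReal.ofReal t * ((N : ℝ≥0∞) - occupation N (constantMode L) Φ.ψ))) + δ →
        ENNReal.ofReal ((1 - β) * N) ≤ occupation N (constantMode L) Ψ.ψ) :
    (⨅ Ψ : TrialState N L, (energy v Ψ +
        ENNReal.ofReal s * ((N : ℝ≥0∞) - occupation N (constantMode L) Ψ.ψ))) ≤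
      groundStateEnergy v N L + ENNReal.ofReal (β * s * N) := by
  set E₀ := groundStateEnergy v N L with hE₀
  refine ENNReal.le_of_forall_pos_le_add fun ε hε _ => ?_
  have hNr : (0 : ℝ) < N := Nat.cast_pos.2 hN
  -- the auxiliary reward `t ≤ s` with `tN ≤ ε/3`
  set t : ℝ := min s ((ε : ℝ) / (3 * N)) with ht
  have hεpos : (0 : ℝ) < ε := hε
  have htpos : 0 < t := lt_min hs (by positivity)
  have hts : t ≤ s := min_le_left _ _
  have htN : t * N ≤ ε / 3 := by
    have h1 : t ≤ ε / (3 * N) := min_le_right _ _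
    calc t * N ≤ ε / (3 * N) * N := by gcongr
      _ = ε / 3 := by field_simp
  obtain ⟨δ, hδ, hδΨ⟩ := hC t htpos (hts.trans hss)
  set δ' : ℝ≥0∞ := min δ (ENNReal.ofReal (ε / 3)) with hδ'
  have hδ'pos : 0 < δ' := lt_min hδ (ENNReal.ofReal_pos.2 (by positivity))
  -- `R(t)` is finite, so a `δ'`-near-minimiser exists
  have hRt_le : (⨅ Φ : TrialState N L, (energy v Φ +
      ENNReal.ofReal t * ((N : ℝ≥0∞) - occupation N (constantMode L) Φ.ψ))) ≤
      E₀ + ENNReal.ofReal (t * N) := nudgedInf_le v htpos.le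
  have hRt_ne : (⨅ Φ : TrialState N L, (energy v Φ +
      ENNReal.ofReal t * ((N : ℝ≥0∞) - occupation N (constantMode L) Φ.ψ))) ≠ ⊤ :=
    ne_top_of_le_ne_top (ENNReal.add_ne_top.2 ⟨hE, ENNReal.ofReal_ne_top⟩) hRt_le
  obtain ⟨Ψ, hΨ⟩ := iInf_lt_iff.1 (ENNReal.lt_add_right hRt_ne hδ'pos.ne')
  set n₀ := occupation N (constantMode L) Ψ.ψ with hn₀
  have hcond : ENNReal.ofReal ((1 - β) * N) ≤ n₀ :=
    hδΨ Ψ (hΨ.le.trans (by gcongr; exact min_le_left _ _))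
  have hdep : (N : ℝ≥0∞) - n₀ ≤ ENNReal.ofReal (β * N) := depletion_le_of_level hβ hcond
  have hEn : energy v Ψ ≤ E₀ + ENNReal.ofReal (t * N) + ENNReal.ofReal (ε / 3) := by
    calc energy v Ψ
        ≤ energy v Ψ + ENNReal.ofReal t * ((N : ℝ≥0∞) - n₀) := le_self_add
      _ ≤ (⨅ Φ : TrialState N L, (energy v Φ +
            ENNReal.ofReal t * ((N : ℝ≥0∞) - occupation N (constantMode L) Φ.ψ))) + δ' := hΨ.le
      _ ≤ (E₀ + ENNReal.ofReal (t * N)) + ENNReal.ofReal (ε / 3) :=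
          add_le_add hRt_le (min_le_right _ _)
  have hsmall : ENNReal.ofReal (t * N) + ENNReal.ofReal (ε / 3) ≤ (ε : ℝ≥0∞) := by
    rw [← ENNReal.ofReal_add (by positivity) (by positivity), ← ENNReal.ofReal_coe_nnreal]
    exact ENNReal.ofReal_le_ofReal (by linarith)
  calc (⨅ Φ : TrialState N L, (energy v Φ +
        ENNReal.ofReal s * ((N : ℝ≥0∞) - occupation N (constantMode L) Φ.ψ)))
      ≤ energy v Ψ + ENNReal.ofReal s * ((N : ℝ≥0∞) - n₀) := iInf_le _ Ψ
    _ ≤ (E₀ + ENNReal.ofReal (t * N) + ENNReal.ofReal (ε / 3)) +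
          ENNReal.ofReal s * ENNReal.ofReal (β * N) := add_le_add hEn (by gcongr)
    _ = E₀ + ENNReal.ofReal (β * s * N) + (ENNReal.ofReal (t * N) + ENNReal.ofReal (ε / 3)) := by
        rw [← ENNReal.ofReal_mul hs.le, show s * (β * N) = β * s * N by ring]
        ring
    _ ≤ E₀ + ENNReal.ofReal (β * s * N) + ε := by gcongr


/-! ## The reward walk at fixed `N` (the birth skeleton's `stub_rewardWalk`) -/

/-- **The reward walk at fixed `N`** (the birth skeleton's `stub_rewardWalk`, now a theorem, with the
extra hypothesis `Measurable v`). There is an absolute constant `K > 0` (`K = 512`) such that for every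
measurable potential `v`, particle number `N ≥ 1`, box `L > 0`, positive parameters `ρ, a` (entering
only through the gap profile `c√(ρa·t)` and the loss `√(s₁/(ρa))`), condensation threshold `η > 0`,
gap / variance constants `c, C > 0`, top reward `s₁ > 0` and levels `0 ≤ b`,
`b + (KC/c)√(s₁/(ρa)) ≤ b' < η`, with `E₀(N,L) < ⊤`: IF on `(0, s₁]` condensation of the
near-minimisers of `F_t = energy + t(N − n̂₀)` at level `η` implies (i) the Ky-Fan gap
`F_t(Φ₁) + F_t(Φ₂) ≥ 2R(t) + c√(ρa·t)` for `L²`-orthogonal pairs and (ii) `⟨Ψ,n̂₀²Ψ⟩ ≤ n₀(Ψ)² + CN`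
for near-minimisers, THEN condensation at level `b` at the top reward `s₁` propagates to condensation
at level `b'` at every reward `t ∈ (0, s₁]`. Proof: the finite induction `Registered.stub_walkInduction`
with `κ = c√(ρa)/(16N)`, `M = 128C/(c√(ρa))`, each step being `abstract_step` fed with the clustering
lemma `Registered.stub_nudgedClustering` and the depletion lemma `Registered.stub_depletionOfVariance`.
This is the finite-difference form of `−R″ ≤ 2Var/Δ` integrated along `(0, s₁]`
[Kato 1966, II §6; Reed–Simon IV, XIII.1–2], with no derivative taken. -/
theorem rewardWalk : ∃ K : ℝ, 0 < K ∧ ∀ (v : ℝ → ℝ≥0∞) (N : ℕ) (L ρ a η c C s₁ b b' : ℝ),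
    Measurable v → 0 < N → 0 < L → 0 < ρ → 0 < a → 0 < η → 0 < c → 0 < C → 0 < s₁ → 0 ≤ b →
    b + K * C / c * Real.sqrt (s₁ / (ρ * a)) ≤ b' → b' < η →
    groundStateEnergy v N L ≠ ⊤ →
    let F : ℝ → TrialState N L → ℝ≥0∞ := fun t Ψ =>
      energy v Ψ + ENNReal.ofReal t * ((N : ℝ≥0∞) - occupation N (constantMode L) Ψ.ψ)
    let Cond : ℝ → ℝ → Prop := fun t β => ∃ δ : ℝ≥0∞, 0 < δ ∧ ∀ Ψ : TrialState N L,
      F t Ψ ≤ (⨅ Φ : TrialState N L, F t Φ) + δ →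
        ENNReal.ofReal ((1 - β) * N) ≤ occupation N (constantMode L) Ψ.ψ
    (∀ t : ℝ, 0 < t → t ≤ s₁ → Cond t η → ∀ Φ₁ Φ₂ : TrialState N L,
        (∫ X, (starRingEnd ℂ) (Φ₁.ψ X) * Φ₂.ψ X) = 0 →
        2 * (⨅ Φ : TrialState N L, F t Φ) + ENNReal.ofReal (c * Real.sqrt (ρ * a * t)) ≤
          F t Φ₁ + F t Φ₂) →
    (∀ t : ℝ, 0 < t → t ≤ s₁ → Cond t η → ∃ δ : ℝ≥0∞, 0 < δ ∧ ∀ Ψ : TrialState N L,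
        F t Ψ ≤ (⨅ Φ : TrialState N L, F t Φ) + δ →
        (∫⁻ X, (‖∑ i : Fin N, (((L ^ 3)⁻¹ : ℝ) : ℂ) *
            (cell L).indicator (fun _ => (1 : ℂ)) (X i) *
            ∫ y in cell L, Ψ.ψ (Function.update X i y)‖₊ : ℝ≥0∞) ^ 2) ≤
          occupation N (constantMode L) Ψ.ψ ^ 2 + ENNReal.ofReal (C * N)) →
    Cond s₁ b → ∀ t : ℝ, 0 < t → t ≤ s₁ → Cond t b' := by
  refine ⟨512, by norm_num, ?_⟩
  intro v N L ρ a η c C s₁ b b' hv hN hL hρ ha hη hc hC hs₁ hb hbb' hb'η hE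
  dsimp only
  intro hGap hVar hInit t₀ ht₀ ht₀s
  have hNr : (0 : ℝ) < N := Nat.cast_pos.2 hN
  -- constants of the mesh
  set w : ℝ := Real.sqrt (ρ * a) with hw_def
  have hw : 0 < w := Real.sqrt_pos.2 (by positivity)
  set κ : ℝ := c * w / (16 * N) with hκ_def
  set M : ℝ := 128 * C / (c * w) with hM_def
  have hκ : 0 < κ := by positivity
  have hM : 0 ≤ M := by positivity
  have hsq : Real.sqrt (s₁ / (ρ * a)) = Real.sqrt s₁ / w := by
    rw [hw_def, Real.sqrt_div hs₁.le]
  have hX : 0 < C / c * (Real.sqrt s₁ / w) := by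
    have : 0 < Real.sqrt s₁ := Real.sqrt_pos.2 hs₁
    positivity
  have hbudget : b + 2 * M * Real.sqrt s₁ < b' := by
    have h1 : 2 * M * Real.sqrt s₁ = 256 * (C / c * (Real.sqrt s₁ / w)) := by
      rw [hM_def]; field_simp; norm_num
    have h2 : 512 * C / c * Real.sqrt (s₁ / (ρ * a)) = 512 * (C / c * (Real.sqrt s₁ / w)) := by
      rw [hsq]; ring
    rw [h2] at hbb'
    rw [h1]
    linarith
  refine Registered.stub_walkInduction (fun t β => ∃ δ : ℝ≥0∞, 0 < δ ∧ ∀ Ψ : TrialState N L,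
      energy v Ψ + ENNReal.ofReal t * ((N : ℝ≥0∞) - occupation N (constantMode L) Ψ.ψ) ≤
        (⨅ Φ : TrialState N L, energy v Φ +
          ENNReal.ofReal t * ((N : ℝ≥0∞) - occupation N (constantMode L) Φ.ψ)) + δ →
        ENNReal.ofReal ((1 - β) * N) ≤ occupation N (constantMode L) Ψ.ψ)
    s₁ κ M η b b' hs₁ hκ hM hb hbudget hb'η ?_ ?_ hInit t₀ ht₀ ht₀s
  · -- monotonicity in the level
    intro t β β' h hle
    exact cond_mono h hle
  · -- one step of the walk
    intro s β σ t hs hss₁ hβ0 hβη hP hσ ht hts hst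
    set g : ℝ := c * Real.sqrt (ρ * a * s) with hg_def
    have hsqs : 0 < Real.sqrt s := Real.sqrt_pos.2 hs
    have hgw : g = c * w * Real.sqrt s := by
      rw [hg_def, hw_def, Real.sqrt_mul (by positivity)]; ring
    have hg : 0 < g := by rw [hgw]; positivity
    have hlevel : β + M * (s - t) / Real.sqrt s + σ = β + 128 * (s - t) * C / g + σ := by
      rw [hgw, hM_def]
      field_simp
    have hst' : s - t ≤ g / (16 * N) := by
      calc s - t ≤ κ * Real.sqrt s := hst
        _ = g / (16 * N) := by rw [hgw, hκ_def]; field_simp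
    rw [hlevel]
    -- condensation at level `η` at `s`, hence gap and variance there
    have hCη := cond_mono hP hβη.le
    have hRs : (⨅ Φ : TrialState N L, energy v Φ +
        ENNReal.ofReal s * ((N : ℝ≥0∞) - occupation N (constantMode L) Φ.ψ)) ≠ ⊤ :=
      ne_top_of_le_ne_top (ENNReal.add_ne_top.2 ⟨hE, ENNReal.ofReal_ne_top⟩)
        (nudgedInf_le v hs.le)
    have hGs := hGap s hs hss₁ hCη
    have hVs := hVar s hs hss₁ hCη
    exact abstract_step (S := TrialState N L)
      (fun r Ψ => energy v Ψ + ENNReal.ofReal r * ((N : ℝ≥0∞) - occupation N (constantMode L) Ψ.ψ))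
      (fun Ψ => occupation N (constantMode L) Ψ.ψ)
      (fun Φ Φ' z => ∫ X, ‖Φ.ψ X - z * Φ'.ψ X‖ ^ 2)
      (fun Ψ => (∫⁻ X, (‖∑ i : Fin N, (((L ^ 3)⁻¹ : ℝ) : ℂ) *
            (cell L).indicator (fun _ => (1 : ℂ)) (X i) *
            ∫ y in cell L, Ψ.ψ (Function.update X i y)‖₊ : ℝ≥0∞) ^ 2) ≤
          occupation N (constantMode L) Ψ.ψ ^ 2 + ENNReal.ofReal (C * N))
      (fun r r' Ψ hr' hrr' => nudged_split (energy v Ψ) (occupation N (constantMode L) Ψ.ψ) hr' hrr')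
      hN ht hts hg hC hβ0 hσ hst' hRs
      (fun δ hδ Φ Φ' hΦ hΦ' => by
        obtain ⟨z, -, hz⟩ := Registered.stub_nudgedClustering v N L s g hv hN hL hs.le hg hRs hGs δ hδ Φ Φ' hΦ hΦ'
        exact ⟨z, hz⟩)
      (fun Ψ Ψ' z η' hη' hVb hρ' =>
        Registered.stub_depletionOfVariance N L hN hL Ψ Ψ' z (C * N) η' (by positivity) hη' hVb hρ')
      hVs hP

/-! ## The assembly -/

/-- **Glue (sorry-free): the fixed-`N` reward walk proves the route's support item `WalkGlue`
(stmt-AtomisticToContinuum-14363) — `NudgedCondensation → NudgeGap → CondensateVariance →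
NudgeRemoval` — BY NAME.** Constants, W0, walk, W3 as in the module docstring. Its axioms are
`propext, Classical.choice, Quot.sound` only (no `sorryAx`): the assembly is a real proof. -/
theorem walkGlue_of_rewardWalk :
    (∃ K : ℝ, 0 < K ∧ ∀ (v : ℝ → ℝ≥0∞) (N : ℕ) (L ρ a η c C s₁ b b' : ℝ),
      Measurable v → 0 < N → 0 < L → 0 < ρ → 0 < a → 0 < η → 0 < c → 0 < C → 0 < s₁ → 0 ≤ b →
      b + K * C / c * Real.sqrt (s₁ / (ρ * a)) ≤ b' → b' < η →
      groundStateEnergy v N L ≠ ⊤ →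
      let F : ℝ → TrialState N L → ℝ≥0∞ := fun t Ψ =>
        energy v Ψ + ENNReal.ofReal t * ((N : ℝ≥0∞) - occupation N (constantMode L) Ψ.ψ)
      let Cond : ℝ → ℝ → Prop := fun t β => ∃ δ : ℝ≥0∞, 0 < δ ∧ ∀ Ψ : TrialState N L,
        F t Ψ ≤ (⨅ Φ : TrialState N L, F t Φ) + δ →
          ENNReal.ofReal ((1 - β) * N) ≤ occupation N (constantMode L) Ψ.ψ
      (∀ t : ℝ, 0 < t → t ≤ s₁ → Cond t η → ∀ Φ₁ Φ₂ : TrialState N L,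
          (∫ X, (starRingEnd ℂ) (Φ₁.ψ X) * Φ₂.ψ X) = 0 →
          2 * (⨅ Φ : TrialState N L, F t Φ) + ENNReal.ofReal (c * Real.sqrt (ρ * a * t)) ≤
            F t Φ₁ + F t Φ₂) →
      (∀ t : ℝ, 0 < t → t ≤ s₁ → Cond t η → ∃ δ : ℝ≥0∞, 0 < δ ∧ ∀ Ψ : TrialState N L,
          F t Ψ ≤ (⨅ Φ : TrialState N L, F t Φ) + δ →
          (∫⁻ X, (‖∑ i : Fin N, (((L ^ 3)⁻¹ : ℝ) : ℂ) *
              (cell L).indicator (fun _ => (1 : ℂ)) (X i) *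
              ∫ y in cell L, Ψ.ψ (Function.update X i y)‖₊ : ℝ≥0∞) ^ 2) ≤
            occupation N (constantMode L) Ψ.ψ ^ 2 + ENNReal.ofReal (C * N)) →
      Cond s₁ b → ∀ t : ℝ, 0 < t → t ≤ s₁ → Cond t b') →
    WalkGlue := by
  intro hWalk hRung hGap hVar v hv τ hτ
  obtain ⟨K, hK, hW⟩ := hWalk
  obtain ⟨ηG, c, ρG, hηG, hc, hρG, hG⟩ := hGap v hv
  obtain ⟨ηV, C, ρV, hηV, hC, hρV, hV⟩ := hVar v hv
  -- constants
  set a : ℝ := (scatteringLength v).toReal with ha_def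
  set η : ℝ := min ηG ηV with hη_def
  have hη : 0 < η := lt_min hηG hηV
  have hηG' : η ≤ ηG := min_le_left _ _
  have hηV' : η ≤ ηV := min_le_right _ _
  set τ' : ℝ := min τ (η / 4) with hτ'_def
  have hτ' : 0 < τ' := lt_min hτ (by positivity)
  have hτ'τ : τ' ≤ τ := min_le_left _ _
  have hτ'η : τ' < η := lt_of_le_of_lt (min_le_right _ _) (by linarith)
  set q : ℝ := c * τ' / (4 * K * C) with hq_def
  have hq : 0 < q := by positivity
  set θ : ℝ := min 1 (q ^ 2) with hθ_def
  have hθ : 0 < θ := lt_min one_pos (by positivity)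
  have hθ1 : θ ≤ 1 := min_le_left _ _
  have hsqrtθ : Real.sqrt θ ≤ q := by
    calc Real.sqrt θ ≤ Real.sqrt (q ^ 2) := Real.sqrt_le_sqrt (min_le_right _ _)
      _ = q := Real.sqrt_sq hq.le
  have hloss : K * C / c * Real.sqrt θ ≤ τ' / 4 := by
    calc K * C / c * Real.sqrt θ ≤ K * C / c * q := by gcongr
      _ = τ' / 4 := by rw [hq_def]; field_simp
  -- the rung at (τ'/4, θ), finiteness of E₀
  obtain ⟨ρR, hρR, hR⟩ := hRung v hv (τ' / 4) θ (by positivity) hθ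
  obtain ⟨ρE, hρE, hEfin⟩ := GroundStateEnergyFinite_holds v hv
  refine ⟨θ, min ρG (min ρV (min ρR ρE)), hθ, hθ1, by positivity, fun ρ hρ hρlt => ?_⟩
  have h1 : ρ < ρG := lt_of_lt_of_le hρlt (min_le_left _ _)
  have h2 : ρ < ρV := lt_of_lt_of_le hρlt ((min_le_right _ _).trans (min_le_left _ _))
  have h3 : ρ < ρR := lt_of_lt_of_le hρlt
    ((min_le_right _ _).trans ((min_le_right _ _).trans (min_le_left _ _)))
  have h4 : ρ < ρE := lt_of_lt_of_le hρlt
    ((min_le_right _ _).trans ((min_le_right _ _).trans (min_le_right _ _)))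
  filter_upwards [hG ρ hρ h1, hV ρ hρ h2, hR ρ hρ h3, hEfin ρ hρ h4,
    Filter.eventually_gt_atTop 0] with N hNG hNV hNR hNE hN
  intro L s₀ R hhyp s hs hss
  -- the degenerate case `a = 0`: `s₀ = 0`, nothing to prove
  rcases (ENNReal.toReal_nonneg : 0 ≤ a).eq_or_lt with ha0 | ha0
  · exfalso
    have ha0' : a = 0 := ha0.symm
    have : s₀ = 0 := by show θ * ρ * a = 0; rw [ha0']; ring
    linarith
  -- main case `a > 0`
  have hNr : (0 : ℝ) < N := Nat.cast_pos.2 hN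
  have hL : 0 < L := Real.rpow_pos_of_pos (div_pos hNr hρ) _
  have hs₀ : 0 < s₀ := by show 0 < θ * ρ * a; positivity
  have hs₀ρa : s₀ ≤ ρ * a := by
    show θ * ρ * a ≤ ρ * a
    calc θ * ρ * a ≤ 1 * ρ * a := by gcongr
      _ = ρ * a := by ring
  have hsq : Real.sqrt (s₀ / (ρ * a)) = Real.sqrt θ := by
    congr 1; show θ * ρ * a / (ρ * a) = θ
    rw [mul_assoc, mul_div_assoc, div_self (by positivity), mul_one]
  have hbudget : τ' / 2 + K * C / c * Real.sqrt (s₀ / (ρ * a)) ≤ τ' := by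
    rw [hsq]; linarith
  -- W0: the rung condenses the near-minimisers at the top reward `s₀` at level `τ'/2`
  have htop := cond_of_rung v hs₀ (by positivity : 0 < τ' / 4) hN hNE hNR
  have hlevel : (1 - 2 * (τ' / 4)) = (1 - τ' / 2) := by ring
  rw [hlevel] at htop
  -- the walk: condensation at level `τ'` for every reward `t ∈ (0, s₀]`
  have hwalk := hW v N L ρ a η c C s₀ (τ' / 2) τ' hv.1 hN hL hρ ha0 hη hc hC hs₀ (by positivity)
    hbudget hτ'η hNE
    (fun t ht hts hcond => hNG t ht (hts.trans hs₀ρa) (cond_mono hcond hηG'))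
    (fun t ht hts hcond => hNV t ht (hts.trans hs₀ρa) (cond_mono hcond hηV'))
    htop
  -- W3
  calc R s ≤ groundStateEnergy v N L + ENNReal.ofReal (τ' * s * N) :=
        removal_of_cond v hs hss hτ'.le hN hNE (fun t ht hts => hwalk t ht hts)
    _ ≤ groundStateEnergy v N L + ENNReal.ofReal (2 * τ * s * N) := by
        gcongr; nlinarith [mul_pos hs hNr]

/-- **The route's support item `WalkGlue` (stmt-AtomisticToContinuum-14363), PROVED**:
`NudgedCondensation → NudgeGap → CondensateVariance → NudgeRemoval`, from the reward walk
`rewardWalk` through `walkGlue_of_rewardWalk`. -/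
theorem walkGlue_proof : WalkGlue :=
  walkGlue_of_rewardWalk rewardWalk

end Summit.AtomisticToContinuum.BoseEinsteinCondensation.Cruxes.NudgeRemoval.Birth

end
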